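import Summits.HubbardSuperconductivity.HubbardSuperconductivity.Theorems.CooperPairDMottWalkCooperPairDMottDWaveResidueStructuralPairField
import Summits.HubbardSuperconductivity.HubbardSuperconductivity.Theorems.LevyLogBootstrapDressHalfFilledPairField
import Literature.MathematicalPhysics.QuantumLattice.TorusPlaquetteDictionaryPairFieldLocal
import HarnessLib

/-!
# Route `LevyLogBootstrap`, crux `DressHalfFilled` (stmt-HubbardSuperconductivity-8148), stub 2
# `stub_plaquetteDictionary`: clause (e) for the dictionary map `Φ = dictionaryMap M U`

Support file: the PAIR-FIELD clause (e) of `PlaquetteDictionary` for the tree's dictionary map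
`Φ = TorusPlaquette.dictionaryMap M U` (columns = Koszul products of plaquette ground states) on the checkerboard
torus of side `2M`, `M ≥ 2`:

  `Φᴴ Δ_d Φ = c(U) Σ_R S⁺_R`,   `Δ_d = pairField dWaveFormFactor (2M)`,   `c(U) = (plaquettePairCouplings U).c`.

Proof (`dictionaryMap_conjTranspose_mul_pairField_mul`): by the plaquette decomposition of the `d`-wave pair field
(`CooperPairDMottWalk.pairField_dWave_eq_sum_jwEmbed_add_inter` with the block family of `FermionTorus.exists_blockFamily`,
whose block sums are sums over the plaquette embeddings, `TorusPlaquette.sum_blockFamily_eq_sum_plaqOrbEmb`)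
`Δ_d = ½ Σ_R (plaqOrbEmb R)_* Δ_d^{(2)} + √2·(inter-plaquette bonds)`, with `Δ_d^{(2)} = 2 Δ_d^{(R)}`
(`pairField_two_eq_two_smul_plaquetteDWavePair`). Between columns of `Φ` the embedded plaquette pair operator at `R`
has the entries of `c · S⁺_R` (`TorusPlaquette.star_col_dotProduct_jwEmbed_plaquetteDWavePair_mulVec_col`) and every
inter-plaquette bond — a difference of two products of annihilation operators on different plaquettes
(`TorusPlaquette.blockOf_ofTorusSite_add_single_ne`) — vanishes
(`TorusPlaquette.star_col_dotProduct_annihilation_mul_annihilation_mulVec_col`).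

References: W.-F. Tsai, S. A. Kivelson, PRB 73 (2006) 214510, App. A (A1); E. Altman, A. Auerbach, PRB 65 (2002) 104508,
§II.D. All statements are [folklore]; no definition is introduced.
-/

set_option linter.dupNamespace false

noncomputable section

namespace Summit.HubbardSuperconductivity.HubbardSuperconductivity.Theorems.LevyLogBootstrap

open Matrix Finset Literature.MathematicalPhysics.QuantumLattice Literature.Probability.LatticeModels
open Literature.MathematicalPhysics.QuantumLattice.TorusPlaquette
open Summit.HubbardSuperconductivity.HubbardSuperconductivity.Theorems.CooperPairDMottWalk
open scoped ComplexOrder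

/-- Entries of a compression: `(Aᴴ B A)_{σ'σ} = ⟨A e_{σ'}, B A e_σ⟩`. [folklore] -/
theorem conjTranspose_mul_mul_apply {m n : Type*} [Fintype m] (A : Matrix m n ℂ) (B : Matrix m m ℂ) (σ' σ : n) :
    (Aᴴ * B * A) σ' σ = star (fun s => A s σ') ⬝ᵥ (B *ᵥ fun s => A s σ) := by
  rw [Matrix.mul_assoc, Matrix.mul_apply]
  refine Finset.sum_congr rfl fun t _ => ?_
  rw [conjTranspose_apply, Matrix.mul_apply, Pi.star_apply, mulVec, dotProduct]

variable {M : ℕ} [NeZero M]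

/-- An inter-plaquette bond pair operator `B_x(eᵢ)`, `xᵢ` odd, has no matrix element between columns of `Φ`.
[folklore] -/
theorem star_col_dotProduct_torusBondPair_mulVec_col (hM : 2 ≤ M) (U : ℝ) (x : TorusSite 2 (2 * M)) (i : Fin 2)
    (hx : ¬ Even (x i).val) (σ' σ : TensorIndex (TorusSite 2 M) 2) :
    star ((plaquettePartition M).prodFamily (plaqFamily U σ')) ⬝ᵥ
        (torusBondPair (2 * M) x i *ᵥ (plaquettePartition M).prodFamily (plaqFamily U σ)) = 0 := by
  have hne : ∀ τ τ' : Fin 2, (plaquettePartition M).cl (orb (FermionTorus.ofTorusSite x) τ) ≠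
      (plaquettePartition M).cl (orb (FermionTorus.ofTorusSite (x + Pi.single i 1)) τ') := by
    intro τ τ'
    rw [plaquettePartition_cl, plaquettePartition_cl]
    exact blockOf_ofTorusSite_add_single_ne hM x i hx
  rw [torusBondPair_eq, sub_mulVec, dotProduct_sub,
    star_col_dotProduct_annihilation_mul_annihilation_mulVec_col U (hne 0 1),
    star_col_dotProduct_annihilation_mul_annihilation_mulVec_col U (hne 1 0), sub_zero]

/-- **Clause (e) of the plaquette-boson dictionary for `Φ = dictionaryMap M U`: `Φᴴ Δ_d Φ = c(U) Σ_R S⁺_R`.**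
[cite: TsaiKivelson2006, App. A (A1)] -/
theorem dictionaryMap_conjTranspose_mul_pairField_mul (hM : 2 ≤ M) (U : ℝ) :
    (dictionaryMap M U)ᴴ * pairField dWaveFormFactor (2 * M) * dictionaryMap M U =
      (((plaquettePairCouplings U).c : ℝ) : ℂ) • ∑ R : TorusSite 2 M, onSite R (spinRaise 1) := by
  classical
  -- the block family `f_c : X ↦ 2c + X` and the plaquette decomposition of `Δ_d`
  obtain ⟨f, hf⟩ := FermionTorus.exists_blockFamily (2 * M) 2 (by omega)
  have hL : Even (2 * M) := even_two_mul M
  have hdec := pairField_dWave_eq_sum_jwEmbed_add_inter hL hf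
  ext σ' σ
  rw [conjTranspose_mul_mul_apply, Matrix.smul_apply, Matrix.sum_apply, smul_eq_mul]
  change star ((plaquettePartition M).prodFamily (plaqFamily U σ')) ⬝ᵥ
      (pairField dWaveFormFactor (2 * M) *ᵥ (plaquettePartition M).prodFamily (plaqFamily U σ)) = _
  rw [hdec, add_mulVec, dotProduct_add, Matrix.smul_mulVec, dotProduct_smul, Matrix.smul_mulVec, dotProduct_smul,
    sub_mulVec, dotProduct_sub, sum_mulVec, dotProduct_sum, sum_mulVec, dotProduct_sum, sum_mulVec, dotProduct_sum]
  -- the inter-plaquette bonds vanish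
  rw [Finset.sum_eq_zero fun x hx => star_col_dotProduct_torusBondPair_mulVec_col hM U x 0 (Finset.mem_filter.1 hx).2 σ' σ,
    Finset.sum_eq_zero fun x hx => star_col_dotProduct_torusBondPair_mulVec_col hM U x 1 (Finset.mem_filter.1 hx).2 σ' σ,
    sub_zero, smul_zero, add_zero]
  -- the block terms: `½ · Σ_R 2 c (S⁺_R)_{σ'σ}`
  rw [sum_blockFamily_eq_sum_plaqOrbEmb hf (fun E => star ((plaquettePartition M).prodFamily (plaqFamily U σ')) ⬝ᵥ
      (jwEmbed E (pairField dWaveFormFactor 2) *ᵥ (plaquettePartition M).prodFamily (plaqFamily U σ)))]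
  simp only [pairField_two_eq_two_smul_plaquetteDWavePair, jwEmbed_smul', Matrix.smul_mulVec, dotProduct_smul, smul_eq_mul]
  have hR : ∀ R : FermionTorus 2 M, star ((plaquettePartition M).prodFamily (plaqFamily U σ')) ⬝ᵥ
      (jwEmbed (plaqOrbEmb M R) plaquetteDWavePair *ᵥ (plaquettePartition M).prodFamily (plaqFamily U σ)) =
        (((plaquettePairCouplings U).c : ℝ) : ℂ) * onSite (FermionTorus.toTorusSite R) (spinRaise 1) σ' σ :=
    fun R => star_col_dotProduct_jwEmbed_plaquetteDWavePair_mulVec_col U R σ' σ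
  simp only [hR]
  rw [← Finset.mul_sum, ← Finset.mul_sum,
    sum_toTorusSite (fun y => onSite y (spinRaise 1) σ' σ), ← mul_assoc, ← mul_assoc]
  norm_num

/-! ### Registered form -/

set_option linter.style.longLine false in
/-- **Registered sub-goal `dressHalfFilled_dictionaryPairField`** (closed form, as registered on the crux item
stmt-HubbardSuperconductivity-8148): clause (e) of `PlaquetteDictionary` for the tree's dictionary map
`TorusPlaquette.dictionaryMap M U` on the checkerboard torus of side `2M`, `M ≥ 2`: `Φᴴ Δ_d Φ = c(U) Σ_R S⁺_R`.
[cite: TsaiKivelson2006, App. A (A1)] -/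
theorem dressHalfFilled_dictionaryPairField : ∀ {M : ℕ} [NeZero M], 2 ≤ M → ∀ (U : ℝ), (TorusPlaquette.dictionaryMap M U)ᴴ * pairField dWaveFormFactor (2 * M) * TorusPlaquette.dictionaryMap M U = (((plaquettePairCouplings U).c : ℝ) : ℂ) • ∑ R : TorusSite 2 M, onSite R (spinRaise 1) :=
  fun hM U => dictionaryMap_conjTranspose_mul_pairField_mul hM U

end Summit.HubbardSuperconductivity.HubbardSuperconductivity.Theorems.LevyLogBootstrap

end
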